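/-
Copyright (c) 2026 the pub-hodgecm-mathlib formalisation cell (harness21).  Prover seat hodgecm-mathlib-K2E1-p10 (g2), Track B ∕ K2-LIT (build stream 29), h413 = `stmt-HodgeConjecture-24833`,
route of record `HCCMUnconditional`, ROADCARD «5Res ENDGAME BY FAMILIES» §2 C7; dealer K2E1-plan (g7) deals (155)∕(169)∕(217) — FILE P1b of the C7 split: `E^{K}` IS GENERATED BY THE CLASSES OF
NICE (continuous, bounded, compactly-supported-mod-`N`, left-`K`-invariant) TEST FUNCTIONS.
-/
import Summits.HodgeConjecture.HodgeConjecture.Theorems.K2E1PseudoEisensteinSmoothDensityU     -- ★ P1a (this seat): `toLp_pseudoEisenstein_mem_closure_of_nice_mem`, `continuous_average`, …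
import Summits.HodgeConjecture.HodgeConjecture.Theorems.K2E1PseudoEisensteinKAverageU2        -- ★ F2b (this seat): `integral_rightRegular_toLp_pseudoEisenstein_eq`, `average_mul_left`, `toLp_pseudoEisenstein_mem_invariants_of_forall`
import HarnessLib

/-!
# h413 ∕ Track B «K2-LIT», ROADCARD «5Res BY FAMILIES» C7, FILE P1b — helper `K2E1PseudoEisensteinNiceGeneratorsU`: `Wᗮ ∩ L²(X)^{K} = closure span {[θ_Ψ] : Ψ ∈ 𝒯_i CONTINUOUS, BOUNDED,
# Ψ = 0 off C·N_i(𝔸) (C compact), Ψ(ι(k)h) = Ψ(h)}` — ★ F2b's head with the NICE generating class (generic `𝒢`; any closed `R`-stable `W` with `Wᗮ = closure span {[θ_Φ] : Φ ∈ 𝒯_i}`)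

Cell `pub/hodgecm-mathlib`, crux h413 = `stmt-HodgeConjecture-24833`, route of record `HCCMUnconditional`; dealer K2E1-plan (g7) (217).  THEOREMS ONLY (no `def`, no `instance`, no notation, no
named-fact hypothesis, no `sorry`); lane `--supports stmt-HodgeConjecture-24833 --as helper` (count-neutral).  Closes no socket.  GENERIC over ★ `AdelicGroupData 𝒢` with closed radicals (`hN`),
an automorphic `μ`, a Haar measure `ν` on `G(𝔸)` (only for the smoothing inside ★ P1a), and a compact group `(Kc, μK)` — topological group, compact, second countable, with a left-, right- and
inversion-invariant probability measure — mapped continuously into `G(𝔸)` by `ι`.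

THE MATHEMATICS.  `E := Wᗮ = closure span Θ` (`hE`) is also `closure span Θ^{nice}` by ★ P1a (truncation + Dirac smoothing), so ★ F1 gives `E ∩ H^{K} = closure span (P_K Θ^{nice})`, and
`P_K[θ_Φ] = [θ_{Φ^♮}]` (★ F2b) with `Φ^♮(h) = ∫_K Φ(ι(k)h) dμK` again NICE: continuous (★ P1a `continuous_average`), bounded, vanishing off `(ι(K)⁻¹·C)·N_i(𝔸)` (compact · radical), and
left-`K`-invariant (★ F2b `average_mul_left`); conversely the classes of nice `K`-invariant test functions are `K`-fixed elements of `E` (★ F2b).  This is the generating class the family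
decomposition (FILE F3d: periodise over the rational torus ★ F3b, decompose along the compact torus quotient ★ F3c) consumes: its members periodise to CONTINUOUS compactly supported functions
on `N(𝔸)B(F)∖G(𝔸)`.

* §1 `span_le_topologicalClosure_span_nice` (★ P1a ⇒ `closure span Θ ≤ closure span Θ^{nice}`).
* §2 **`orthogonal_inf_invariants_eq_topologicalClosure_span_nice`** (the head; the three sets enter through abbreviation hypotheses `hΘ`, `hΘn`, `hΘKn` — pass `rfl rfl rfl`).

HONEST LABEL: HC_CM is proved only modulo the 7 printed citations (2 remaining named inputs: hLiu418 = `stmt-HodgeConjecture-24832`, h413 = `stmt-HodgeConjecture-24833`) until rung 0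
closes; this file asserts no named fact and closes no socket.
References: [MoeglinWaldspurger1995] C. Mœglin, J.-L. Waldspurger, *Spectral Decomposition and Eisenstein Series*, II.1.2–II.1.4, II.1.12; [DeitmarEchterhoff2014] A. Deitmar, S. Echterhoff,
*Principles of Harmonic Analysis*, 2nd ed., Lemma 6.2.2, Lemma 7.2.6; [GetzHahn2024] J. R. Getz, H. Hahn, *An Introduction to Automorphic Representations*, §9.3.
-/

set_option autoImplicit false
set_option linter.dupNamespace false  -- the mandated namespace repeats the summit's segment (`HodgeConjecture.HodgeConjecture`)

noncomputable section

open MeasureTheory Measure Set Filter Topology CompactlySupported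
open Literature.MeasureTheory.Group Literature.NumberTheory.Automorphic ContRepresentation
open Summit.HodgeConjecture.HodgeConjecture.Cruxes.H413.K2E1PseudoEisensteinCuspOrthogonal (memLp_two_pseudoEisenstein_automorphicQuotient)
open Summit.HodgeConjecture.HodgeConjecture.Cruxes.H413.K2E1PseudoEisensteinSmoothDensityU
open Summit.HodgeConjecture.HodgeConjecture.Cruxes.H413.K2E1PseudoEisensteinKAverageU2
open Summit.HodgeConjecture.HodgeConjecture.Cruxes.H413.K2E1KAverageProjectionU (inf_invariants_eq_topologicalClosure_span_image_average)
open scoped ENNReal NNReal Pointwise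

namespace Summit.HodgeConjecture.HodgeConjecture.Cruxes.H413.K2E1PseudoEisensteinNiceGeneratorsU

universe u

variable {K : Type} [Field K] [NumberField K] (𝒢 : AdelicGroupData.{u} K)
  [MeasurableSpace 𝒢.Adelic] [BorelSpace 𝒢.Adelic] [LocallyCompactSpace 𝒢.Adelic] [SecondCountableTopology 𝒢.Adelic] [T2Space 𝒢.Adelic]
  [DiscreteTopology 𝒢.quotientSubgroup] (𝔓 : 𝒢.ParabolicUnipotentData)
  (μ : Measure 𝒢.automorphicQuotient) [𝒢.IsAutomorphicMeasure μ]
  (ν : Measure 𝒢.Adelic) [ν.IsHaarMeasure]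
  {Kc : Type*} [Group Kc] [TopologicalSpace Kc] [IsTopologicalGroup Kc] [CompactSpace Kc] [SecondCountableTopology Kc] [MeasurableSpace Kc] [BorelSpace Kc]
  (μK : Measure Kc) [IsProbabilityMeasure μK] [μK.IsMulLeftInvariant] [μK.IsMulRightInvariant] [μK.IsInvInvariant] (ι : Kc →* 𝒢.Adelic)

/-! ## §1 `closure span Θ ≤ closure span Θ^{nice}` (★ P1a) -/

include ν in
omit [IsTopologicalGroup Kc] [CompactSpace Kc] [SecondCountableTopology Kc] [MeasurableSpace Kc] [BorelSpace Kc] in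
/-- **THE NICE CLASSES HAVE THE SAME CLOSED SPAN AS ALL OF `Θ`**: `(span Θ).topologicalClosure ≤ (span Θ^{nice}).topologicalClosure` (★ P1a `toLp_pseudoEisenstein_mem_closure_of_nice_mem` puts every
`[θ_Ψ] ∈ Θ` in the closure of `span Θ^{nice}`). [cite: MoeglinWaldspurger1995, II.1.2] [cite: DeitmarEchterhoff2014, Lemma 6.2.2] -/
theorem topologicalClosure_span_le_nice (hN : ∀ i : 𝔓.ι, IsClosed ((𝔓.radical i : Subgroup 𝒢.Adelic) : Set 𝒢.Adelic)) {Θ Θn : Set (𝒢.L2 μ)}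
    (hΘ : Θ = {f : 𝒢.L2 μ | ∃ (i : 𝔓.ι) (Φ : 𝒢.Adelic → ℂ) (_ : Measurable Φ) (_ : ∀ (g : 𝒢.Adelic) (n : 𝔓.radical i), Φ (g * n) = Φ g)
        (_ : ∫⁻ x, (∑' q : 𝒢.quotientSubgroup ⧸ (𝔓.radical i).subgroupOf 𝒢.quotientSubgroup, ‖Φ ((Quotient.out x : 𝒢.Adelic) * ((q.out : 𝒢.quotientSubgroup) : 𝒢.Adelic))‖ₑ) ^ 2 ∂μ < ∞)
        (hθ : MemLp (fun x : 𝒢.automorphicQuotient => ∑' q : 𝒢.quotientSubgroup ⧸ (𝔓.radical i).subgroupOf 𝒢.quotientSubgroup,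
          Φ ((Quotient.out x : 𝒢.Adelic) * ((q.out : 𝒢.quotientSubgroup) : 𝒢.Adelic))) 2 μ), f = hθ.toLp _})
    (hΘn : Θn = {f : 𝒢.L2 μ | ∃ (i : 𝔓.ι) (Φ : 𝒢.Adelic → ℂ) (_ : Measurable Φ) (_ : ∀ (g : 𝒢.Adelic) (n : 𝔓.radical i), Φ (g * n) = Φ g)
        (_ : ∫⁻ x, (∑' q : 𝒢.quotientSubgroup ⧸ (𝔓.radical i).subgroupOf 𝒢.quotientSubgroup, ‖Φ ((Quotient.out x : 𝒢.Adelic) * ((q.out : 𝒢.quotientSubgroup) : 𝒢.Adelic))‖ₑ) ^ 2 ∂μ < ∞)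
        (_ : Continuous Φ) (_ : ∃ M : ℝ, ∀ g, ‖Φ g‖ ≤ M) (_ : ∃ C : Set 𝒢.Adelic, IsCompact C ∧ ∀ g, g ∉ C * ((𝔓.radical i : Subgroup 𝒢.Adelic) : Set 𝒢.Adelic) → Φ g = 0)
        (hθ : MemLp (fun x : 𝒢.automorphicQuotient => ∑' q : 𝒢.quotientSubgroup ⧸ (𝔓.radical i).subgroupOf 𝒢.quotientSubgroup,
          Φ ((Quotient.out x : 𝒢.Adelic) * ((q.out : 𝒢.quotientSubgroup) : 𝒢.Adelic))) 2 μ), f = hθ.toLp _}) :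
    (Submodule.span ℂ Θ).topologicalClosure ≤ (Submodule.span ℂ Θn).topologicalClosure := by
  refine Submodule.topologicalClosure_minimal _ (Submodule.span_le.2 fun f hf => ?_) (Submodule.isClosed_topologicalClosure _)
  rw [hΘ] at hf
  obtain ⟨j, Ψ, hΨm, hΨ, h2, hθ, rfl⟩ := hf
  show hθ.toLp _ ∈ ((Submodule.span ℂ Θn).topologicalClosure : Set (𝒢.L2 μ))
  rw [Submodule.topologicalClosure_coe]
  refine toLp_pseudoEisenstein_mem_closure_of_nice_mem 𝒢 𝔓 j μ ν (hN j) hΨm hΨ h2 fun Φ hΦm hΦ h2Φ hc hb hs => Submodule.subset_span ?_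
  rw [hΘn]
  exact ⟨j, Φ, hΦm, hΦ, h2Φ, hc, hb, hs, memLp_two_pseudoEisenstein_automorphicQuotient 𝒢 𝔓 j μ hΦm hΦ h2Φ, rfl⟩

/-! ## §2 The head with the nice `K`-invariant generators -/

include ν μK in
/-- **`Wᗮ ∩ L²(X)^{K} = closure span {[θ_Ψ] : Ψ ∈ 𝒯_i continuous, bounded, Ψ = 0 off C·N_i(𝔸) (C compact), Ψ left-K-invariant}`** for any closed `R`-stable `W` with `Wᗮ = closure span Θ` (`hE`;
`W = L²_cusp` by ★ f1), closed radicals (`hN`) and a compact group `(Kc, μK) → G(𝔸)`: §1 + ★ F1 + ★ F2b (`P_K[θ_Φ] = [θ_{Φ^♮}]`) + ★ P1a (`Φ^♮` is again nice: continuous, bounded, vanishing off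
`(ι(K)⁻¹·C)·N_i(𝔸)`) — the generating class of ROADCARD C7's family decomposition.  (Sets through `hΘ hΘn hΘKn`: pass `rfl rfl rfl`.) [cite: MoeglinWaldspurger1995, II.1.2–II.1.4] [cite: DeitmarEchterhoff2014, Lemma 7.2.6] -/
theorem orthogonal_inf_invariants_eq_topologicalClosure_span_nice (hN : ∀ i : 𝔓.ι, IsClosed ((𝔓.radical i : Subgroup 𝒢.Adelic) : Set 𝒢.Adelic)) (hι : Continuous ι)
    (W : ClosedSubrep (𝒢.rightRegular μ)) {Θ Θn ΘKn : Set (𝒢.L2 μ)}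
    (hΘ : Θ = {f : 𝒢.L2 μ | ∃ (i : 𝔓.ι) (Φ : 𝒢.Adelic → ℂ) (_ : Measurable Φ) (_ : ∀ (g : 𝒢.Adelic) (n : 𝔓.radical i), Φ (g * n) = Φ g)
        (_ : ∫⁻ x, (∑' q : 𝒢.quotientSubgroup ⧸ (𝔓.radical i).subgroupOf 𝒢.quotientSubgroup, ‖Φ ((Quotient.out x : 𝒢.Adelic) * ((q.out : 𝒢.quotientSubgroup) : 𝒢.Adelic))‖ₑ) ^ 2 ∂μ < ∞)
        (hθ : MemLp (fun x : 𝒢.automorphicQuotient => ∑' q : 𝒢.quotientSubgroup ⧸ (𝔓.radical i).subgroupOf 𝒢.quotientSubgroup,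
          Φ ((Quotient.out x : 𝒢.Adelic) * ((q.out : 𝒢.quotientSubgroup) : 𝒢.Adelic))) 2 μ), f = hθ.toLp _})
    (hΘn : Θn = {f : 𝒢.L2 μ | ∃ (i : 𝔓.ι) (Φ : 𝒢.Adelic → ℂ) (_ : Measurable Φ) (_ : ∀ (g : 𝒢.Adelic) (n : 𝔓.radical i), Φ (g * n) = Φ g)
        (_ : ∫⁻ x, (∑' q : 𝒢.quotientSubgroup ⧸ (𝔓.radical i).subgroupOf 𝒢.quotientSubgroup, ‖Φ ((Quotient.out x : 𝒢.Adelic) * ((q.out : 𝒢.quotientSubgroup) : 𝒢.Adelic))‖ₑ) ^ 2 ∂μ < ∞)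
        (_ : Continuous Φ) (_ : ∃ M : ℝ, ∀ g, ‖Φ g‖ ≤ M) (_ : ∃ C : Set 𝒢.Adelic, IsCompact C ∧ ∀ g, g ∉ C * ((𝔓.radical i : Subgroup 𝒢.Adelic) : Set 𝒢.Adelic) → Φ g = 0)
        (hθ : MemLp (fun x : 𝒢.automorphicQuotient => ∑' q : 𝒢.quotientSubgroup ⧸ (𝔓.radical i).subgroupOf 𝒢.quotientSubgroup,
          Φ ((Quotient.out x : 𝒢.Adelic) * ((q.out : 𝒢.quotientSubgroup) : 𝒢.Adelic))) 2 μ), f = hθ.toLp _})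
    (hΘKn : ΘKn = {f : 𝒢.L2 μ | ∃ (i : 𝔓.ι) (Φ : 𝒢.Adelic → ℂ) (_ : Measurable Φ) (_ : ∀ (g : 𝒢.Adelic) (n : 𝔓.radical i), Φ (g * n) = Φ g)
        (_ : ∫⁻ x, (∑' q : 𝒢.quotientSubgroup ⧸ (𝔓.radical i).subgroupOf 𝒢.quotientSubgroup, ‖Φ ((Quotient.out x : 𝒢.Adelic) * ((q.out : 𝒢.quotientSubgroup) : 𝒢.Adelic))‖ₑ) ^ 2 ∂μ < ∞)
        (_ : Continuous Φ) (_ : ∃ M : ℝ, ∀ g, ‖Φ g‖ ≤ M) (_ : ∃ C : Set 𝒢.Adelic, IsCompact C ∧ ∀ g, g ∉ C * ((𝔓.radical i : Subgroup 𝒢.Adelic) : Set 𝒢.Adelic) → Φ g = 0)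
        (_ : ∀ (k : Kc) (h : 𝒢.Adelic), Φ (ι k * h) = Φ h)
        (hθ : MemLp (fun x : 𝒢.automorphicQuotient => ∑' q : 𝒢.quotientSubgroup ⧸ (𝔓.radical i).subgroupOf 𝒢.quotientSubgroup,
          Φ ((Quotient.out x : 𝒢.Adelic) * ((q.out : 𝒢.quotientSubgroup) : 𝒢.Adelic))) 2 μ), f = hθ.toLp _})
    (hE : (W.toSubmodule)ᗮ = (Submodule.span ℂ Θ).topologicalClosure) :
    (W.toSubmodule)ᗮ ⊓ ((𝒢.rightRegular μ).restrict ι).invariants = (Submodule.span ℂ ΘKn).topologicalClosure := by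
  have hu := 𝒢.isUnitary_rightRegular μ
  have hc : ((𝒢.rightRegular μ).restrict ι).IsStronglyContinuous := fun v => ((𝒢.isStronglyContinuous_rightRegular_holds μ) v).comp hι
  have hEW : (W.orthogonal hu).toSubmodule = (W.toSubmodule)ᗮ := ClosedSubrep.toSubmodule_orthogonal hu W
  -- `Θ ⊆ E`, `Θn ⊆ Θ ⊆ E`, and `E ≤ closure span Θn` (§1)
  have hΘE : Θ ⊆ W.orthogonal hu := fun f hf => by
    show f ∈ (W.orthogonal hu).toSubmodule
    rw [hEW, hE]
    exact Submodule.le_topologicalClosure _ (Submodule.subset_span hf)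
  have hnΘ : Θn ⊆ Θ := fun f hf => by
    rw [hΘn] at hf
    obtain ⟨j, Φ, hΦm, hΦ, h2, -, -, -, hθ, rfl⟩ := hf
    rw [hΘ]; exact ⟨j, Φ, hΦm, hΦ, h2, hθ, rfl⟩
  have hSE : Θn ⊆ W.orthogonal hu := hnΘ.trans hΘE
  have hES : (W.orthogonal hu).toSubmodule ≤ (Submodule.span ℂ Θn).topologicalClosure := by
    rw [hEW, hE]; exact topologicalClosure_span_le_nice 𝒢 𝔓 μ ν hN hΘ hΘn
  have hF1 := inf_invariants_eq_topologicalClosure_span_image_average ι μK hu hc (W.orthogonal hu) hSE hES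
  rw [hEW] at hF1
  -- (a) the average of a nice class is a nice `K`-invariant class
  have ha : ∀ f ∈ Θn, (∫ k, 𝒢.rightRegular μ (ι k) f ∂μK) ∈ ΘKn := by
    intro f hf
    rw [hΘn] at hf
    obtain ⟨j, Φ, hΦm, hΦ, h2, hΦc, ⟨M, hM⟩, ⟨C, hC, hCΦ⟩, hθ, rfl⟩ := hf
    obtain ⟨hm, hN', h2', heq⟩ := integral_rightRegular_toLp_pseudoEisenstein_eq 𝒢 𝔓 j μ μK ι hι hΦm hΦ h2
    rw [hΘKn]
    refine ⟨j, fun h : 𝒢.Adelic => ∫ k, Φ (ι k * h) ∂μK, hm, hN', h2', continuous_average μK hι hΦc, ⟨M, norm_average_le μK ι hM⟩,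
      ⟨(Set.range ι)⁻¹ * C, (isCompact_range hι).inv.mul hC, fun g hg => average_eq_zero_of_forall μK ι (S := C * ((𝔓.radical j : Subgroup 𝒢.Adelic) : Set 𝒢.Adelic)) hCΦ ?_⟩,
      fun k h => average_mul_left 𝒢 μK ι Φ k h, memLp_two_pseudoEisenstein_automorphicQuotient 𝒢 𝔓 j μ hm hN' h2', heq⟩
    rwa [← mul_assoc]
  -- (b) nice `K`-invariant classes are `K`-fixed elements of `Wᗮ`
  have hb : ΘKn ⊆ ((W.toSubmodule)ᗮ ⊓ ((𝒢.rightRegular μ).restrict ι).invariants : Submodule ℂ (𝒢.L2 μ)) := by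
    intro f hf
    rw [hΘKn] at hf
    obtain ⟨j, Φ, hΦm, hΦ, h2, -, -, -, hK, hθ, rfl⟩ := hf
    refine ⟨?_, toLp_pseudoEisenstein_mem_invariants_of_forall 𝒢 𝔓 j μ ι hΦm hΦ h2 hK⟩
    rw [← hEW]
    exact hΘE (by rw [hΘ]; exact ⟨j, Φ, hΦm, hΦ, h2, hθ, rfl⟩)
  refine le_antisymm ?_ ?_
  · rw [hF1]
    refine Submodule.topologicalClosure_mono (Submodule.span_le.2 ?_)
    rintro _ ⟨f, hf, rfl⟩
    exact Submodule.subset_span (ha f hf)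
  · refine Submodule.topologicalClosure_minimal _ (Submodule.span_le.2 hb) ?_
    rw [hF1]
    exact Submodule.isClosed_topologicalClosure _

end Summit.HodgeConjecture.HodgeConjecture.Cruxes.H413.K2E1PseudoEisensteinNiceGeneratorsU

end
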